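import Literature.NumberTheory.Transcendental.ZilberFieldQuasiminimalProps
import Literature.NumberTheory.Transcendental.ZilberProp115
import Literature.NumberTheory.Transcendental.ZilberProp112
import Literature.NumberTheory.Transcendental.GammaPointsDense
import Literature.NumberTheory.Transcendental.WeakZPStar
import HarnessLib

/-!
# Bays–Kirby 2018, Theorem 1.5: `ℂ_exp` exponentially-algebraically closed ⟹ quasiminimal

Discharge of the named fact `Literature.NumberTheory.Transcendental.isQuasiminimal_of_isExpAlgClosed`
(`Zilber.lean`; M. Bays, J. Kirby, *Pseudo-exponential maps, variants, and quasiminimality*,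
Algebra & Number Theory 12 (2018), Thm 1.5): `theorem isQuasiminimal_of_isExpAlgClosed_holds`.

**Assembly** (the printed proof, p. 38: Cor. 11.7 + Prop. 10.7). Cor. 11.7 = Thm 11.6 with
`K = Γcl(∅)`: quasiminimality from the countable closure property and `ℵ₀`-saturation for
Γ-algebraic extensions over `K`; the tree has this step with the saturation of the field itself as
hypothesis (`GammaField.isQuasiminimal_of_ccp_of_saturatedOver`, any universe). Saturation is
Prop. 11.2 (`BaysKirby2018_prop_11_2_holds`, proved) applied to generic strong Γ-closedness over
`K`, which is Prop. 11.5 applied to generic Γ-closedness over `K`, which follows from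
Γ-closedness = EAC via the Zariski density of Γ-points
(`BaysKirby2018_gammaPoints_dense_of_isExpAlgClosed_holds`, `isGenericallyGammaClosedOver_of_dense`).
Prop. 11.5 is proved in the tree relative to its weak Zilber–Pink input
(`GammaField.isGenericallyStronglyGammaClosedOver_of_weakZP`, hypothesis `hZP` = Thm 11.4 for the
linear slices of every Zariski closed `W`), and that input is proved over `ℂ`
(`WeakZP.weakZPBound_complex`, `WeakZPStar.lean`: Ax–Kirby–Zilber differential algebra,
ultraproduct compactness, induction on the ambient subtorus for the clause `(*)`). The countable
closure property of `ℂ_exp` is Prop. 10.7 (`hasCountableClosureProperty_complex_holds`).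

## References

* M. Bays, J. Kirby, *Pseudo-exponential maps, variants, and quasiminimality*, ANT 12 (2018):
  Thm 1.5, Prop. 10.7, Prop. 11.2, Thm 11.4, Prop. 11.5, Thm 11.6, Cor. 11.7.
-/

noncomputable section

open Set

namespace Literature.NumberTheory.Transcendental

namespace GammaField

open Literature.ModelTheory.ExponentialFields.ExponentialRing

/-- **Generic strong Γ-closedness of `ℂ_exp` over every Γ-closed `K`, granted EAC** (Bays–Kirby
2018, Cor. 11.7 (proof: "clearly Γ-closedness implies generic Γ-closedness") + Prop. 11.5 over
`ℂ`): EAC ⟹ Zariski density of Γ-points (`BaysKirby2018_gammaPoints_dense_of_isExpAlgClosed_holds`)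
⟹ GΓC over `K` (`isGenericallyGammaClosedOver_of_dense`) ⟹ GSΓC over `K` by Prop. 11.5
(`isGenericallyStronglyGammaClosedOver_of_weakZP`), whose weak Zilber–Pink input — Thm 11.4 for
linear slices — is `WeakZP.weakZPBound_complex`. [cite: BaysKirby2018ANT, Prop. 11.5, Cor. 11.7 (proof)] -/
theorem isGenericallyStronglyGammaClosedOver_complex_of_isExpAlgClosed (hEAC : IsExpAlgClosed ℂ)
    {K : Submodule ℚ ℂ} (hKΓ : IsGammaClosed K) : IsGenericallyStronglyGammaClosedOver K :=
  isGenericallyStronglyGammaClosedOver_of_weakZP hKΓ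
    (fun _ _ hW => WeakZP.weakZPBound_complex hW)
    (isGenericallyGammaClosedOver_of_dense K
      (BaysKirby2018_gammaPoints_dense_of_isExpAlgClosed_holds Complex.isAlgClosed
        isSurjectiveOntoUnits_complex hEAC))

end GammaField

open GammaField Literature.ModelTheory.ExponentialFields.ExponentialRing in
/-- **Bays–Kirby 2018, Theorem 1.5.** If `ℂ_exp` is exponentially-algebraically closed then it is
quasiminimal: every subset of `ℂ` definable with parameters in `⟨ℂ; +, ·, exp⟩` is countable or
co-countable — discharge of the named fact
`Literature.NumberTheory.Transcendental.isQuasiminimal_of_isExpAlgClosed`. Proof as printed (p. 38,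
Cor. 11.7 + Prop. 10.7): by `GammaField.isQuasiminimal_of_ccp_of_saturatedOver` (Thm 11.6 with
`K = Γcl(∅) = ℚ·ecl ∅`, from CCP `hasCountableClosureProperty_complex_holds`) it suffices that
`ℂ_exp` be `ℵ₀`-saturated for Γ-algebraic strong extensions over `K`; `K` is countable (CCP),
Γ-closed (`isGammaClosed_span_ecl_of_countable`) and proper (`ℂ` is uncountable), so this is
Prop. 11.2 (`BaysKirby2018_prop_11_2_holds`) applied to generic strong Γ-closedness over `K`
(`GammaField.isGenericallyStronglyGammaClosedOver_complex_of_isExpAlgClosed`: Prop. 11.5 with the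
weak Zilber–Pink theorem proved over `ℂ`). [cite: BaysKirby2018ANT, Thm 1.5] -/
theorem isQuasiminimal_of_isExpAlgClosed_holds : isQuasiminimal_of_isExpAlgClosed := by
  intro hEAC
  have hccp : HasCountableClosureProperty ℂ := hasCountableClosureProperty_complex_holds
  refine isQuasiminimal_of_ccp_of_saturatedOver hccp fun hs hs' h hδ _ => ?_
  have hKc : ((Submodule.span ℚ (ecl (∅ : Set ℂ)) : Submodule ℚ ℂ) : Set ℂ).Countable :=
    countable_span_ecl hccp countable_empty
  have hKΓ : IsGammaClosed (Submodule.span ℚ (ecl (∅ : Set ℂ))) :=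
    isGammaClosed_span_ecl_of_countable hccp countable_empty
  have hKtop : (Submodule.span ℚ (ecl (∅ : Set ℂ)) : Submodule ℚ ℂ) ≠ ⊤ := by
    intro htop
    apply not_countable_univ (α := ℂ)
    have : ((⊤ : Submodule ℚ ℂ) : Set ℂ) = univ := rfl
    rw [← this, ← htop]
    exact hKc
  exact BaysKirby2018_prop_11_2_holds Complex.isAlgClosed isSurjectiveOntoUnits_complex hKΓ hKtop hKc
    (isGenericallyStronglyGammaClosedOver_complex_of_isExpAlgClosed hEAC hKΓ) hs hs' h hδ

end Literature.NumberTheory.Transcendental
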